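import Summits.KontsevichZagierPeriods.Zeta5Search.LaiSweepShard

/-!
# `κ₃` sweep certificate — shard file 027 of 127 (shards 189–195 of 889)

HONEST FRAMING. Systematic search; no irrationality claim unless certified. This file only checks,
by `decide +kernel`, shards 189–195 of the order-cell sweep of the `κ₃` point `(74, 2180, 444; δ74)`
(engine `LaiSweepEngine`, soundness `LaiSweepJump/Free/Eval/Shard/Kappa3`; a shard is `⟨regime, n,
p, q, p', q', Lo, Up⟩`: `n` cells from `p/q` to `p'/q'` with integer rate sums in `[Lo, Up]`, `K =
128`, `D = 2^40`). It draws NO conclusion: only the capstone `LaiKappa3SweepCert`, which needs all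
127 shard files, does. Kernel cost of this file ≈ 560 cells × 0.3 s.
-/

namespace Summit.KontsevichZagierPeriods.Zeta5Search.Sweep

set_option maxHeartbeats 100000000 in
/-- Shard 189: 80 cells of regime B from `11/92` to `51/422`.
[cite: Lai2024BallRivoal, §4 Lemma 4.3] -/
theorem shard189 :
    Shard.check 128 (2^40)
      ⟨true, 80, 11, 92, 51, 422, 55384903305823, 55877905118078⟩ = true := by
  decide +kernel

set_option maxHeartbeats 100000000 in
/-- Shard 190: 80 cells of regime B from `51/422` to `37/303`.
[cite: Lai2024BallRivoal, §4 Lemma 4.3] -/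
theorem shard190 :
    Shard.check 128 (2^40)
      ⟨true, 80, 51, 422, 37, 303, 53528165657943, 54013769221227⟩ = true := by
  decide +kernel

set_option maxHeartbeats 100000000 in
/-- Shard 191: 80 cells of regime B from `37/303` to `47/381`.
[cite: Lai2024BallRivoal, §4 Lemma 4.3] -/
theorem shard191 :
    Shard.check 128 (2^40)
      ⟨true, 80, 37, 303, 47, 381, 52529780818700, 53016493923576⟩ = true := by
  decide +kernel

set_option maxHeartbeats 100000000 in
/-- Shard 192: 80 cells of regime B from `47/381` to `33/265`.
[cite: Lai2024BallRivoal, §4 Lemma 4.3] -/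
theorem shard192 :
    Shard.check 128 (2^40)
      ⟨true, 80, 47, 381, 33, 265, 48553457788472, 49011335705306⟩ = true := by
  decide +kernel

set_option maxHeartbeats 100000000 in
/-- Shard 193: 80 cells of regime B from `33/265` to `52/413`.
[cite: Lai2024BallRivoal, §4 Lemma 4.3] -/
theorem shard193 :
    Shard.check 128 (2^40)
      ⟨true, 80, 33, 265, 52, 413, 56748748172260, 57320568030980⟩ = true := by
  decide +kernel

set_option maxHeartbeats 100000000 in
/-- Shard 194: 80 cells of regime B from `52/413` to `52/409`.
[cite: Lai2024BallRivoal, §4 Lemma 4.3] -/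
theorem shard194 :
    Shard.check 128 (2^40)
      ⟨true, 80, 52, 413, 52, 409, 50058093150874, 50553555095958⟩ = true := by
  decide +kernel

set_option maxHeartbeats 100000000 in
/-- Shard 195: 80 cells of regime B from `52/409` to `33/257`.
[cite: Lai2024BallRivoal, §4 Lemma 4.3] -/
theorem shard195 :
    Shard.check 128 (2^40)
      ⟨true, 80, 52, 409, 33, 257, 51250263137319, 51770609149065⟩ = true := by
  decide +kernel

/-- The checked shards of this file, in order. [folklore] -/
def shards027 : List (CheckedShard 128 (2^40)) :=
  [⟨_, shard189⟩, ⟨_, shard190⟩, ⟨_, shard191⟩, ⟨_, shard192⟩, ⟨_, shard193⟩,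
    ⟨_, shard194⟩, ⟨_, shard195⟩]

end Summit.KontsevichZagierPeriods.Zeta5Search.Sweep
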